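/-
Copyright (c) 2026 the pub-hodgecm-mathlib formalisation cell (harness21).  Prover seat hodgecm-mathlib-K2E1-p11 (g2), Track B ∕ K2-LIT, h413 =
`stmt-HodgeConjecture-24833`, line `K2_E1_TraceFormulaBeta`, campaign «EIS-R7-BL-SPH-3» ∕ R8-LADDER-3, «MS-3» — POLE EXCLUSION AT `N = 2` — the §-twin of (123)(iii) (dealer K2E1-plan (g6)
«Same at N = 2 as §-twins if cheap», 2026-09-04T11:15:18Z): [MW] IV.3.12 (a) — the Maass–Selberg bounds (a1)∧(a2)∧(a3) for the continued intertwining scalar `c̃` of `U(1,1)∕CM` AT EVERY POINT of the per-ball holomorphy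
domain `D₁ := (D⁺ ∩ D_n ∩ U) ∖ P`, letter-free modulo the ★ X1∕X2 binders — CLOSER₂ ∘ the general-box `_on'` edition ∘ the topology of `D₁` (open convex minus countable).
-/
import Summits.HodgeConjecture.HodgeConjecture.Theorems.K2E1MaassSelbergFamilyCMTwo                -- ★ p859643 (this seat): CLOSER₂ `exists_truncatedFamily_cm_two`
import Summits.HodgeConjecture.HodgeConjecture.Theorems.K2E1MaassSelbergContinuedOnBoxesCMTwo       -- ★ p859607 (K2E4-p11): `poleControl_continued_cm_two_of_family_on'`
import Summits.HodgeConjecture.HodgeConjecture.Theorems.K2E1SphericalEisensteinPoleExclusionCMThree -- ★∕📤 p859741 (this seat): §1 `countable_ball_diff_of_codiscrete` (rank-free)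
import Summits.HodgeConjecture.HodgeConjecture.Theorems.K2E1ConvexDiffCountableConnected           -- ★ p859595 (K2E4-p11): `isPreconnected_convex_diff_of_countable` (rank-free)
import HarnessLib

/-!
# h413 ∕ Track B «K2-LIT», «MS-3» — `K2E1SphericalEisensteinPoleExclusionCMTwo`: [MW] IV.3.12 (a) for `U(1,1)∕CM` on `D₁ = (D⁺ ∩ D_n ∩ U) ∖ P` — the Maass–Selberg bounds
# (a1)∧(a2)∧(a3) for the continued scalar `c̃` AT EVERY `z ∈ D₁` (`N = 2`), in particular the locally uniform bound (a2) near every putative pole `z₁ ∈ P ∩ D⁺`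

Cell `pub/hodgecm-mathlib`, crux H413 = `stmt-HodgeConjecture-24833`, route `HCCMUnconditional`; dealer K2E1-plan (g6) deal (123)(iii).  THEOREMS ONLY (no `def` ∕ `instance` ∕ `notation` ∕
named-fact hypothesis ∕ `sorry`; default heartbeats); lane `--kind proof --supports stmt-HodgeConjecture-24833 --as helper` (count-neutral; closes no socket).
WHAT.  Per ball `D_n = ball 0 (n+2)` (`2 ≤ n`, weight `k = n + 3`), with the objects of ★ X1 `exists_ball_package_cm_two` and the global continuation (E1)∕(E5) of ★ X2 AS BINDERS
(`U` open dense co-discrete in `D_n`, `vX` holomorphic on `U`, test functions `h_j`, …; `Ec`, a CLOSED COUNTABLE exceptional set `P`), the idelic∕constant-term package of ★ p859344∕p859607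
(`μK νI 𝓕I ν 𝓕 h𝓕1 h𝓕c β`), `φ₀ ≠ 0`, and the continued scalar `c̃` holomorphic on `D₁ := ({½ < Re, 0 < Im} ∩ D_n ∩ U) ∖ P` with (hceq) on the tube `{1 < Re}`:
**`∃ T₀ ≥ 1, ∀ z ∈ D₁, (a1)∧(a2)∧(a3)`** of ★ p858755 `poleControl_continued_cm_two_of_pairing` (for `c̃`, base `T₀`, abscissa `Re z − ½`).  Since `P ∩ D⁺` consists of isolated points of
the open `D⁺ ∩ D_n`, every putative pole `z₁ ∈ P ∩ D⁺` has a punctured neighbourhood inside `D₁` on which (a2) bounds `c̃` uniformly — the input of the removable-singularity bricks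
((L4), K2E4-p10): «no pole of `c̃` (hence of the spherical `Ec`) in `{½ < Re z < 1} ∖ ℝ`».
HOW.  `(T₀, Fam)` := ★ CLOSER₂ on `U ∖ P` (restricted to `D₁`; `hFtube` from (E1)); `D₁` is open (`P` closed), preconnected (`D₁ = C ∖ S` with `C := D⁺ ∩ D_n` open convex and
`S := (D_n ∖ U) ∪ P` countable — ★ `isPreconnected_convex_diff_of_countable`; `D_n ∖ U` is countable because it is discrete by the co-discreteness clause of X1), and contains the open
non-empty boxes `O₁ := D₁ ∩ {3 < Re < 4, 0 < Im < 1}`, `O₂' := D₁ ∩ {1 < Re < 2, 0 < Im < 1}` (non-empty: `Sᶜ` is dense and `⟨3.1, 0.1⟩`, `⟨1.1, 0.1⟩ ∈ C`, using `2 ≤ n`); then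
★ `poleControl_continued_cm_two_of_family_on'`.
* §2 **`poleExclusion_bounds_cm_two`** — THE HEAD (§1 of the `N = 3` file is reused by import).
HONEST LABEL.  Count-neutral helper; proves no printed statement; letter-free except the X1∕X2∕idelic binders it is fed; HC_CM is proved only modulo the 7 printed citations (2 remaining named
inputs: hLiu418 = `stmt-HodgeConjecture-24832`, h413 = `stmt-HodgeConjecture-24833`) until rung 0 closes.

## References
* [MoeglinWaldspurger1995] C. Mœglin, J.-L. Waldspurger, *Spectral decomposition and Eisenstein series* (1995), IV.2.3, IV.3.12 (a).
* [BernsteinLapid2019] J. Bernstein, E. Lapid, *On the meromorphic continuation of Eisenstein series*, J. AMS 37 (2024), Thm 2.3, §4.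
* [Arthur1980TraceFormulaII] J. Arthur, *A trace formula for reductive groups II*, Compositio Math. 40 (1980), §4.
-/

set_option autoImplicit false
-- the mandated namespace repeats `HodgeConjecture.HodgeConjecture`, as in every `Theorems/*.lean` of this sub-problem
set_option linter.dupNamespace false

noncomputable section

open MeasureTheory MeasureTheory.Measure Set NumberField IsDedekindDomain Filter Topology
open scoped NNReal ENNReal ComplexConjugate
open Literature.MeasureTheory.Group Literature.NumberTheory
open Literature.NumberTheory.Automorphic Literature.NumberTheory.Automorphic.UnitaryGroup AdelicGroupData
open Summit.HodgeConjecture.HodgeConjecture.Cruxes.H413.K2E1BorelEisensteinU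
open Summit.HodgeConjecture.HodgeConjecture.Cruxes.H413.K2E1BLBorelSpacesU2Defs
open Summit.HodgeConjecture.HodgeConjecture.Cruxes.H413.K2E1BLBorelOperatorsU2Defs
open Summit.HodgeConjecture.HodgeConjecture.Cruxes.H413.K2E1MaassSelbergFamilyCMTwo (exists_truncatedFamily_cm_two)
open Summit.HodgeConjecture.HodgeConjecture.Cruxes.H413.K2E1MaassSelbergContinuedOnBoxesCMTwo (poleControl_continued_cm_two_of_family_on')
open Summit.HodgeConjecture.HodgeConjecture.Cruxes.H413.K2E1ConvexDiffCountableConnected (isPreconnected_convex_diff_of_countable)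
open Summit.HodgeConjecture.HodgeConjecture.Cruxes.H413.K2E1SphericalEisensteinPoleExclusionCMThree (countable_ball_diff_of_codiscrete)

namespace Summit.HodgeConjecture.HodgeConjecture.Cruxes.H413.K2E1SphericalEisensteinPoleExclusionCMTwo

/-! ## §2 The Maass–Selberg bounds on `D₁ = (D⁺ ∩ D_n ∩ U) ∖ P` -/

section Head

variable (L : Type) [Field L] [NumberField L] [IsCMField L]
  [MeasurableSpace (quasiSplit (↥(maximalRealSubfield L)) L (IsCMField.complexConj L) 2).Adelic] [BorelSpace (quasiSplit (↥(maximalRealSubfield L)) L (IsCMField.complexConj L) 2).Adelic]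
  [MeasurableSpace (AdeleRing (𝓞 L) L)ˣ] [BorelSpace (AdeleRing (𝓞 L) L)ˣ]

/-- **POLE EXCLUSION AT `N = 2` — [MW] IV.3.12 (a) ON `D₁ = (D⁺ ∩ D_n ∩ U) ∖ P`, `D⁺ = {½ < Re, 0 < Im}`** (module docstring): `∃ T₀ ≥ 1, ∀ z ∈ D₁, (a1)∧(a2)∧(a3)` for the continued scalar `c̃`, base `T₀`.
[cite: MoeglinWaldspurger1995, IV.2.3, IV.3.12 (a)] [cite: BernsteinLapid2019, Thm 2.3, §4] [cite: Arthur1980TraceFormulaII, §4] -/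
theorem poleExclusion_bounds_cm_two
    -- structural letters: the measures (as ★ X1 ∕ ★ p859379)
    (μ : Measure (quasiSplit (↥(maximalRealSubfield L)) L (IsCMField.complexConj L) 2).automorphicQuotient) [(quasiSplit (↥(maximalRealSubfield L)) L (IsCMField.complexConj L) 2).IsAutomorphicMeasure μ]
    (νG : Measure (quasiSplit (↥(maximalRealSubfield L)) L (IsCMField.complexConj L) 2).Adelic) [νG.IsHaarMeasure] [νG.IsInvInvariant] [SFinite νG]
    (μK : Measure ((standardMaximalCompactGL 2 L).comap (adelicVal (↥(maximalRealSubfield L)) L (IsCMField.complexConj L) 2 ((StdForm.antidiagonal 2).over L)) : Subgroup (quasiSplit (↥(maximalRealSubfield L)) L (IsCMField.complexConj L) 2).Adelic))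
    [μK.IsHaarMeasure]
    (νI : Measure (AdeleRing (𝓞 L) L)ˣ) [νI.IsHaarMeasure]
    {𝓕I : Set (AdeleRing (𝓞 L) L)ˣ} (h𝓕I : IsIdeleClassDomain L 𝓕I)
    (ν : Measure ↥(adelicUnipotent (↥(maximalRealSubfield L)) L (IsCMField.complexConj L) 2)) [ν.IsHaarMeasure] [ν.IsMulRightInvariant] [ν.IsInvInvariant]
    {𝓕 : Set ↥(adelicUnipotent (↥(maximalRealSubfield L)) L (IsCMField.complexConj L) 2)}
    (h𝓕N : IsFundamentalDomain ↥(rationalUnipotent (↥(maximalRealSubfield L)) L (IsCMField.complexConj L) 2) 𝓕 ν) (h𝓕c : IsCompact (closure 𝓕)) (h𝓕1 : ν 𝓕 = 1)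
    {β : (quasiSplit (↥(maximalRealSubfield L)) L (IsCMField.complexConj L) 2).Adelic → ℝ≥0∞}
    (hβ : IsCoveringWeight ↥((arithmeticBorel (↥(maximalRealSubfield L)) L (IsCMField.complexConj L) 2).map (quasiSplit (↥(maximalRealSubfield L)) L (IsCMField.complexConj L) 2).arithmeticSubgroup.subtype) β)
    {μZ : Measure (borelQuotient (↥(maximalRealSubfield L)) L (IsCMField.complexConj L) 2)} [SFinite μZ]
    (hμZ : ∀ f : borelQuotient (↥(maximalRealSubfield L)) L (IsCMField.complexConj L) 2 → ℝ≥0∞, Measurable f → ∫⁻ z, f z ∂μZ = ∫⁻ g, β g * f (toBorelQuotient (↥(maximalRealSubfield L)) L (IsCMField.complexConj L) 2 g) ∂νG)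
    -- X1's per-ball objects (ball `D_n = ball 0 (n+2)`, weight `k = n + 4`)
    (n : ℕ) {I : Type} [Fintype I] (η : I → GL (Fin 2) (AdeleRing (𝓞 L) L) → ℝ) (h : I → (quasiSplit (↥(maximalRealSubfield L)) L (IsCMField.complexConj L) 2).Adelic → ℂ) (a : ℝ≥0) (κ : I → ℝ≥0)
    (T : I → HX (↥(maximalRealSubfield L)) L (IsCMField.complexConj L) 2 (n + 3) μ →L[ℂ] HX (↥(maximalRealSubfield L)) L (IsCMField.complexConj L) 2 (n + 3) μ) (U : Set ℂ)
    (vX : ℂ → HX (↥(maximalRealSubfield L)) L (IsCMField.complexConj L) 2 (n + 3) μ)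
    -- X1's clauses (only those used)
    (hη : ∀ i, IsTestFunctionGL 2 L (η i))
    (hdef : ∀ i, h i = fun y : (quasiSplit (↥(maximalRealSubfield L)) L (IsCMField.complexConj L) 2).Adelic => orbitalSmoothing νG (fun x : (quasiSplit (↥(maximalRealSubfield L)) L (IsCMField.complexConj L) 2).Adelic => ((η i (adelicVal (↥(maximalRealSubfield L)) L (IsCMField.complexConj L) 2 ((StdForm.antidiagonal 2).over L) x) : ℝ) : ℂ)) (fun x : (quasiSplit (↥(maximalRealSubfield L)) L (IsCMField.complexConj L) 2).Adelic => ((η i (adelicVal (↥(maximalRealSubfield L)) L (IsCMField.complexConj L) 2 ((StdForm.antidiagonal 2).over L) x) : ℝ) : ℂ)) y)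
    (hreg : ∀ i, Continuous (h i) ∧ HasCompactSupport (h i))
    (hcov : ∀ z ∈ Metric.ball (0 : ℂ) (n + 2), ∃ i, (∫ x, h i x * (((borelHeight x : ℝ≥0) : ℝ) : ℂ) ^ z ∂νG) ≠ 0)
    (ha : 0 < a) (hκ : ∀ i, 1 ≤ κ i)
    (hΩ : ∀ i, ∀ z : borelQuotient (↥(maximalRealSubfield L)) L (IsCMField.complexConj L) 2, ∀ y ∈ tsupport (h i), borelQuotHeight (↥(maximalRealSubfield L)) L (IsCMField.complexConj L) 2 z ≤ κ i * borelQuotHeight (↥(maximalRealSubfield L)) L (IsCMField.complexConj L) 2 (rightShift (↥(maximalRealSubfield L)) L (IsCMField.complexConj L) 2 y z))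
    (hTX : ∀ i, ∀ u : HX (↥(maximalRealSubfield L)) L (IsCMField.complexConj L) 2 (n + 3) μ, (T i u : (quasiSplit (↥(maximalRealSubfield L)) L (IsCMField.complexConj L) 2).automorphicQuotient → ℂ) =ᵐ[μ.withDensity fun x => (((supHeight (↥(maximalRealSubfield L)) L (IsCMField.complexConj L) 2 x)⁻¹ ^ (2 * (n + 3)) : ℝ≥0) : ℝ≥0∞)]
      fun ξ => ∫ y, h i y * (u : (quasiSplit (↥(maximalRealSubfield L)) L (IsCMField.complexConj L) 2).automorphicQuotient → ℂ) (y⁻¹ • ξ) ∂νG)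
    (hUo : IsOpen U) (hUD : U ⊆ Metric.ball (0 : ℂ) (n + 2)) (hvX : DifferentiableOn ℂ vX U)
    -- the global continued function, the exceptional set, and the pointwise representation (E5) (★ X2)
    (Ec : ℂ → (quasiSplit (↥(maximalRealSubfield L)) L (IsCMField.complexConj L) 2).Adelic → ℂ) (P : Set ℂ)
    (hE5 : ∀ j, ∀ z ∈ U, z ∉ P → (∫ x, h j x * (((borelHeight x : ℝ≥0) : ℝ) : ℂ) ^ z ∂νG) ≠ 0 → ∀ g : (quasiSplit (↥(maximalRealSubfield L)) L (IsCMField.complexConj L) 2).Adelic,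
      Ec z g = (∫ x, h j x * (((borelHeight x : ℝ≥0) : ℝ) : ℂ) ^ z ∂νG)⁻¹ *
        ∫ y, h j y * ((vX z : HX (↥(maximalRealSubfield L)) L (IsCMField.complexConj L) 2 (n + 3) μ) : (quasiSplit (↥(maximalRealSubfield L)) L (IsCMField.complexConj L) 2).automorphicQuotient → ℂ)
          ((quasiSplit (↥(maximalRealSubfield L)) L (IsCMField.complexConj L) 2).toAutomorphicQuotient (g * y)⁻¹) ∂νG)
    (hUcod : ∀ z₀ ∈ Metric.ball (0 : ℂ) (n + 2), ∀ᶠ s in 𝓝[≠] z₀, s ∈ U) (hn : 2 ≤ n)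
    -- (E1): the Godement agreement of the global continuation; the exceptional set is closed and countable
    {φ₀ : ℂ} (hφ₀ : φ₀ ≠ 0) (hE1 : ∀ z : ℂ, 1 < z.re → Ec z = eisensteinSeriesU (flatSectionU (fun _ : (quasiSplit (↥(maximalRealSubfield L)) L (IsCMField.complexConj L) 2).Adelic => φ₀) z))
    (hPc : IsClosed P) (hPcount : P.Countable)
    -- the continued intertwining scalar on `D₁`
    {c : ℂ → ℂ} (hc : DifferentiableOn ℂ c (({z : ℂ | 1 / 2 < z.re ∧ 0 < z.im} ∩ Metric.ball (0 : ℂ) (n + 2) ∩ U) \ P)) (hceq : ∀ z : ℂ, 1 < z.re → c z = (∫ v : ↥(adelicUnipotent (↥(maximalRealSubfield L)) L (IsCMField.complexConj L) 2), (((borelHeight ((quasiSplit (↥(maximalRealSubfield L)) L (IsCMField.complexConj L) 2).toAdelic (weylLongU ((IsCMField.complexConj L : L ≃ₐ[↥(maximalRealSubfield L)] L) : L →+* L) (rfl : (StdForm.antidiagonal 2).over L = (StdForm.antidiagonal 2).over L)) * (v : (quasiSplit (↥(maximalRealSubfield L)) L (IsCMField.complexConj L) 2).Adelic))) : ℝ)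 : ℂ) ^ z ∂ν))
 :
    ∃ T₀ : ℝ≥0, 1 ≤ T₀ ∧ ∀ z ∈ (({z : ℂ | 1 / 2 < z.re ∧ 0 < z.im} ∩ Metric.ball (0 : ℂ) (n + 2) ∩ U) \ P),
        Real.sqrt ((∫ x in {x : (AdeleRing (𝓞 L) L)ˣ | (IdeleClassGroup.ideleNorm L x : ℝ) ≤ 1} ∩ 𝓕I, (IdeleClassGroup.ideleNorm L x : ℝ) ∂νI) * μK.real Set.univ * ‖c z‖ ^ 2 * ‖φ₀‖ ^ 2) ≤ (z.re - 1 / 2) * (T₀ : ℝ) ^ (2 * (z.re - 1 / 2)) * Real.sqrt ((∫ x in {x : (AdeleRing (𝓞 L) L)ˣ | (IdeleClassGroup.ideleNorm L x : ℝ) ≤ 1} ∩ 𝓕I, (IdeleClassGroup.ideleNorm L x : ℝ) ∂νI) * μK.real Set.univ * ‖φ₀‖ ^ 2) / |z.im| +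
        Real.sqrt ((z.re - 1 / 2) ^ 2 * (T₀ : ℝ) ^ (4 * (z.re - 1 / 2)) * ((∫ x in {x : (AdeleRing (𝓞 L) L)ˣ | (IdeleClassGroup.ideleNorm L x : ℝ) ≤ 1} ∩ 𝓕I, (IdeleClassGroup.ideleNorm L x : ℝ) ∂νI) * μK.real Set.univ * ‖φ₀‖ ^ 2) / z.im ^ 2 + ((∫ x in {x : (AdeleRing (𝓞 L) L)ˣ | (IdeleClassGroup.ideleNorm L x : ℝ) ≤ 1} ∩ 𝓕I, (IdeleClassGroup.ideleNorm L x : ℝ) ∂νI) * μK.real Set.univ * ‖φ₀‖ ^ 2) * (T₀ : ℝ) ^ (4 * (z.re - 1 / 2))) ∧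
        (∀ {x₁ x₂ η : ℝ}, 0 < x₁ → (z.re - 1 / 2) ∈ Set.Icc x₁ x₂ → 0 < η → η ≤ |z.im| →
        (∫ x in {x : (AdeleRing (𝓞 L) L)ˣ | (IdeleClassGroup.ideleNorm L x : ℝ) ≤ 1} ∩ 𝓕I, (IdeleClassGroup.ideleNorm L x : ℝ) ∂νI) * μK.real Set.univ * ‖c z‖ ^ 2 * ‖φ₀‖ ^ 2 ≤ (x₂ * (T₀ : ℝ) ^ (2 * x₂) * Real.sqrt ((∫ x in {x : (AdeleRing (𝓞 L) L)ˣ | (IdeleClassGroup.ideleNorm L x : ℝ) ≤ 1} ∩ 𝓕I, (IdeleClassGroup.ideleNorm L x : ℝ) ∂νI) * μK.real Set.univ * ‖φ₀‖ ^ 2) / η + Real.sqrt (x₂ ^ 2 * (T₀ : ℝ) ^ (4 * x₂) * ((∫ x in {x : (AdeleRing (𝓞 L) L)ˣ | (IdeleClassGroup.ideleNorm L x : ℝ) ≤ 1} ∩ 𝓕I, (IdeleClassGroup.ideleNorm L x : ℝ) ∂νI) * μK.real Set.univ * ‖φ₀‖ ^ 2) / η ^ 2 + ((∫ x in {x : (AdeleRing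 (𝓞 L) L)ˣ | (IdeleClassGroup.ideleNorm L x : ℝ) ≤ 1} ∩ 𝓕I, (IdeleClassGroup.ideleNorm L x : ℝ) ∂νI) * μK.real Set.univ * ‖φ₀‖ ^ 2) * (T₀ : ℝ) ^ (4 * x₂))) ^ 2) ∧
        (|z.im| ≤ 1 → (∫ x in {x : (AdeleRing (𝓞 L) L)ˣ | (IdeleClassGroup.ideleNorm L x : ℝ) ≤ 1} ∩ 𝓕I, (IdeleClassGroup.ideleNorm L x : ℝ) ∂νI) * μK.real Set.univ * ‖c z‖ ^ 2 * ‖φ₀‖ ^ 2 ≤ ((z.re - 1 / 2) * (T₀ : ℝ) ^ (2 * (z.re - 1 / 2)) * Real.sqrt ((∫ x in {x : (AdeleRing (𝓞 L) L)ˣ | (IdeleClassGroup.ideleNorm L x : ℝ) ≤ 1} ∩ 𝓕I, (IdeleClassGroup.ideleNorm L x : ℝ) ∂νI) * μK.real Set.univ * ‖φ₀‖ ^ 2) +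
        Real.sqrt ((z.re - 1 / 2) ^ 2 * (T₀ : ℝ) ^ (4 * (z.re - 1 / 2)) * ((∫ x in {x : (AdeleRing (𝓞 L) L)ˣ | (IdeleClassGroup.ideleNorm L x : ℝ) ≤ 1} ∩ 𝓕I, (IdeleClassGroup.ideleNorm L x : ℝ) ∂νI) * μK.real Set.univ * ‖φ₀‖ ^ 2) + ((∫ x in {x : (AdeleRing (𝓞 L) L)ˣ | (IdeleClassGroup.ideleNorm L x : ℝ) ≤ 1} ∩ 𝓕I, (IdeleClassGroup.ideleNorm L x : ℝ) ∂νI) * μK.real Set.univ * ‖φ₀‖ ^ 2) * (T₀ : ℝ) ^ (4 * (z.re - 1 / 2)))) ^ 2 / z.im ^ 2) := by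
  -- the family on `U ∖ P` (★ CLOSER₂)
  obtain ⟨T₀, hT₀, Fam, hFd, hFam⟩ := exists_truncatedFamily_cm_two L μ νG ν h𝓕N h𝓕c (by rw [h𝓕1]; exact one_ne_zero) hβ hμZ n η h a κ T U vX
    hη hdef hreg hcov ha hκ hΩ hTX hUo hUD hvX Ec P hE5
  -- the domain `D₁ = C ∖ S`, `C := D⁺ ∩ D_n` open convex, `S := (D_n ∖ U) ∪ P` countable
  set D₁ : Set ℂ := ({z : ℂ | 1 / 2 < z.re ∧ 0 < z.im} ∩ Metric.ball (0 : ℂ) (n + 2) ∩ U) \ P with hD₁def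
  set C : Set ℂ := {z : ℂ | 1 / 2 < z.re ∧ 0 < z.im} ∩ Metric.ball (0 : ℂ) (n + 2) with hCdef
  set S : Set ℂ := (Metric.ball (0 : ℂ) (n + 2) \ U) ∪ P with hSdef
  have hQo : IsOpen {z : ℂ | 1 / 2 < z.re ∧ 0 < z.im} := (isOpen_lt continuous_const Complex.continuous_re).inter (isOpen_lt continuous_const Complex.continuous_im)
  have hCo : IsOpen C := hQo.inter Metric.isOpen_ball
  have hCc : Convex ℝ C := ((convex_halfSpace_re_gt (1 / 2)).inter (convex_halfSpace_im_gt 0)).inter (convex_ball (0 : ℂ) (n + 2))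
  have hSc : S.Countable := (countable_ball_diff_of_codiscrete hUcod).union hPcount
  have hDCS : D₁ = C \ S := by
    ext z
    simp only [hD₁def, hCdef, hSdef, Set.mem_sdiff, Set.mem_inter_iff, Set.mem_union, not_or, not_and, not_not]
    constructor
    · rintro ⟨⟨⟨hq, hb⟩, hU⟩, hP⟩
      exact ⟨⟨hq, hb⟩, fun _ => hU, hP⟩
    · rintro ⟨⟨hq, hb⟩, hU, hP⟩
      exact ⟨⟨⟨hq, hb⟩, hU hb⟩, hP⟩
  have hD₁o : IsOpen D₁ := (hCo.inter hUo).sdiff hPc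
  have hD₁c : IsPreconnected D₁ := by
    rw [hDCS]
    exact isPreconnected_convex_diff_of_countable Literature.Topology.Euclidean.one_lt_rank_real_complex hCc hCo hSc
  have hD₁sub : D₁ ⊆ {z : ℂ | 1 / 2 < z.re ∧ 0 < z.im} := fun z hz => hz.1.1.1
  have hD₁UP : D₁ ⊆ U \ P := fun z hz => ⟨hz.1.2, hz.2⟩
  -- the boxes
  have hn' : (2 : ℝ) ≤ n := by exact_mod_cast hn
  have hdense : Dense Sᶜ := hSc.dense_compl ℝ
  have hbox : ∀ (a b : ℝ) (w : ℂ), a < w.re → w.re < b → 0 < w.im → w.im < 1 → 1 / 2 < w.re → ‖w‖ < n + 2 →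
      IsOpen (D₁ ∩ {z : ℂ | (a < z.re ∧ z.re < b) ∧ (0 < z.im ∧ z.im < 1)}) ∧ (D₁ ∩ {z : ℂ | (a < z.re ∧ z.re < b) ∧ (0 < z.im ∧ z.im < 1)}).Nonempty := by
    intro a b w h1 h2 h3 h4 h5 h6
    have hBo : IsOpen {z : ℂ | (a < z.re ∧ z.re < b) ∧ (0 < z.im ∧ z.im < 1)} :=
      ((isOpen_lt continuous_const Complex.continuous_re).inter (isOpen_lt Complex.continuous_re continuous_const)).inter
        ((isOpen_lt continuous_const Complex.continuous_im).inter (isOpen_lt Complex.continuous_im continuous_const))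
    refine ⟨hD₁o.inter hBo, ?_⟩
    have hwC : w ∈ C ∩ {z : ℂ | (a < z.re ∧ z.re < b) ∧ (0 < z.im ∧ z.im < 1)} := ⟨⟨⟨h5, h3⟩, mem_ball_zero_iff.2 h6⟩, ⟨h1, h2⟩, ⟨h3, h4⟩⟩
    obtain ⟨z, ⟨hzC, hzB⟩, hzS⟩ := hdense.inter_open_nonempty _ (hCo.inter hBo) ⟨w, hwC⟩
    refine ⟨z, ⟨?_, hzB⟩⟩
    rw [hDCS]
    exact ⟨hzC, hzS⟩
  have hw₁ : ‖(⟨31 / 10, 1 / 10⟩ : ℂ)‖ < n + 2 :=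
    lt_of_le_of_lt (Complex.norm_le_abs_re_add_abs_im _) (by norm_num [abs_of_pos]; linarith)
  have hw₂ : ‖(⟨11 / 10, 1 / 10⟩ : ℂ)‖ < n + 2 :=
    lt_of_le_of_lt (Complex.norm_le_abs_re_add_abs_im _) (by norm_num [abs_of_pos]; linarith)
  obtain ⟨hO₁o, hO₁ne⟩ := hbox 3 4 ⟨31 / 10, 1 / 10⟩ (by norm_num) (by norm_num) (by norm_num) (by norm_num) (by norm_num) hw₁
  obtain ⟨hO₂o, hO₂ne⟩ := hbox 1 2 ⟨11 / 10, 1 / 10⟩ (by norm_num) (by norm_num) (by norm_num) (by norm_num) (by norm_num) hw₂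
  have hsep : ∀ z ∈ D₁ ∩ {z : ℂ | (3 < z.re ∧ z.re < 4) ∧ (0 < z.im ∧ z.im < 1)}, ∀ z' ∈ D₁ ∩ {z : ℂ | (1 < z.re ∧ z.re < 2) ∧ (0 < z.im ∧ z.im < 1)}, 1 < z'.re ∧ z'.re < z.re :=
    fun z hz z' hz' => ⟨hz'.2.1.1, by linarith [hz'.2.1.2, hz.2.1.1]⟩
  -- the family on `D₁` and its tube identity
  have hFd₁ : DifferentiableOn ℂ Fam D₁ := hFd.mono hD₁UP
  have hFtube : ∀ z ∈ D₁, 1 < z.re → ((Fam z : Lp ℂ 2 μ) : (quasiSplit (↥(maximalRealSubfield L)) L (IsCMField.complexConj L) 2).automorphicQuotient → ℂ) =ᵐ[μ]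
      (quasiSplit (↥(maximalRealSubfield L)) L (IsCMField.complexConj L) 2).quotFun (truncation ν 𝓕 T₀ (eisensteinSeriesU (flatSectionU (fun _ : (quasiSplit (↥(maximalRealSubfield L)) L (IsCMField.complexConj L) 2).Adelic => φ₀) z))) := by
    intro z hz hz2
    rw [← hE1 z hz2]
    exact hFam z (hD₁UP hz)
  refine ⟨T₀, hT₀, fun z hz => ?_⟩
  exact poleControl_continued_cm_two_of_family_on' L hD₁o hD₁c hD₁sub hO₁o hO₁ne Set.inter_subset_left hO₂o hO₂ne Set.inter_subset_left hsep
    μ νG μK νI h𝓕I ν h𝓕N h𝓕1 h𝓕c hT₀ hφ₀ hβ hc hceq Fam hFd₁ hFtube hz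

end Head

end Summit.HodgeConjecture.HodgeConjecture.Cruxes.H413.K2E1SphericalEisensteinPoleExclusionCMTwo

end
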